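import Literature.Analysis.FluidPDE.CompressibleEulerImplosionArrival
import Literature.Analysis.FluidPDE.CompressibleEulerImplosionODEMaximal
import Literature.Analysis.FluidPDE.CompressibleEulerImplosionP0Entry
import Literature.Analysis.FluidPDE.CompressibleEulerImplosionOriginSeries
import HarnessLib

/-!
# Buckmaster–Cao-Labora–Gómez-Serrano at `γ = 5/3`: Proposition 2.5 — the smooth solution from `P₀` reaches `P_s`

Topic `Literature/Analysis/FluidPDE`; namespace
`Literature.Analysis.FluidPDE.BuckmasterCaolaboraGomezserrano2025.Monatomic`. Companion of
`CompressibleEulerImplosion.lean` (named fact `BuckmasterCaolaboraGomezserrano2025_thm11_monatomic`,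
THEOREM 1.1 of T. Buckmaster, G. Cao-Labora, J. Gómez-Serrano, *Smooth imploding solutions for 3D
compressible fluids*, Forum Math. Pi 13 (2025) e6, arXiv:2208.09445, at `γ = 5/3`, `α = 1/3`);
joins `CompressibleEulerImplosionArrival.lean` (no complete trajectory in the triangle `𝒯^{(H)}`;
maximal trajectories trapped in `𝒯^{(H)}` tend to `P_s`), `CompressibleEulerImplosionODEMaximal.lean`
(maximal continuation), `CompressibleEulerImplosionP0Entry.lean` (a profile at `ζ = 0` gives a
trajectory of (1.8) near `ξ = −∞` entering `𝒯^{(H)}`) and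
`CompressibleEulerImplosionOriginSeries.lean` (Prop. 2.5, first part: the origin series).

Brick D (complete) of the discharge plan — **Proposition 2.5, second part, at `γ = 5/3`**:
* `exists_continuation_tendsto_Ps`: for `1 < r < r*`, a solution of (1.8) off the sonic lines on
  `(a₀, T₀)` lying in a triangle `𝒯^{(H)}` at some `a ∈ (a₀, T₀)` continues to a solution on
  `(a₀, b)`, `b ≥ T₀`, off the sonic lines, staying in `𝒯^{(H)} ∖ {D_Z = 0}` on `[a, b)` with `W`
  strictly decreasing, and tending to `P_s` as `ξ → b⁻`;
* `exists_trajectory_of_profile`: every profile `𝒲` solving (1.10) on a punctured neighbourhood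
  of `0`, differentiable there, with `𝒲(0) > 0`, `𝒲′(0) = 1 − r`, generates a solution `(W, Z)` of
  (1.8) on a half-line `(−∞, b)` equal near `−∞` to `(e^{−ξ}𝒲(e^ξ), −e^{−ξ}𝒲(−e^ξ))`, off both
  sonic lines with `Z < W`, `W` eventually strictly decreasing, converging to `P_s` as `ξ → b⁻`;
* `exists_P0_trajectory`: the same for the origin series `𝒲 = OriginSeries.profile r A`, `A > 0`
  ("the smooth solution issued from `P₀` reaches `P_s`"), plus `originProfile_analytic`.
Theorems only. [cite: BuckmasterCaolaboraGomezserrano2025, Prop. 2.5, Remark 2.6]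
-/

noncomputable section

open Set Filter Metric Topology

namespace Literature.Analysis.FluidPDE

namespace BuckmasterCaolaboraGomezserrano2025

namespace Monatomic

open ODE

variable {r : ℝ}

/-- Gluing an extension defined from an interior time onto the original solution. [folklore] -/
theorem hasDerivAt_splice {F : ℝ × ℝ → ℝ × ℝ} {c c' : ℝ → ℝ × ℝ} {a₀ a b b' : ℝ}
    (hab : a < b) (hc : ∀ ξ ∈ Ioo a₀ b, HasDerivAt c (F (c ξ)) ξ)
    (hc' : ∀ ξ ∈ Ioo a b', HasDerivAt c' (F (c' ξ)) ξ) (heq : EqOn c' c (Ioo a b)) :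
    ∃ c'' : ℝ → ℝ × ℝ, EqOn c'' c (Ioo a₀ b) ∧ EqOn c'' c' (Ioo a b') ∧
      ∀ ξ ∈ Ioo a₀ b', HasDerivAt c'' (F (c'' ξ)) ξ := by
  set s₀ : ℝ := (a + b) / 2 with hs₀
  have has₀ : a < s₀ := by simp only [hs₀]; linarith
  have hs₀b : s₀ < b := by simp only [hs₀]; linarith
  set c'' : ℝ → ℝ × ℝ := fun ξ => if ξ < s₀ then c ξ else c' ξ with hc''
  have he₁ : EqOn c'' c (Ioo a₀ b) := fun ξ hξ => by
    by_cases h : ξ < s₀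
    · simp only [hc'', if_pos h]
    · simp only [hc'', if_neg h]; exact heq ⟨has₀.trans_le (not_lt.mp h), hξ.2⟩
  have he₂ : EqOn c'' c' (Ioo a b') := fun ξ hξ => by
    by_cases h : ξ < s₀
    · simp only [hc'', if_pos h]; exact (heq ⟨hξ.1, h.trans hs₀b⟩).symm
    · simp only [hc'', if_neg h]
  refine ⟨c'', he₁, he₂, fun ξ hξ => ?_⟩
  rcases lt_or_ge ξ b with h | h
  · have hmem : ξ ∈ Ioo a₀ b := ⟨hξ.1, h⟩
    have hev : c'' =ᶠ[𝓝 ξ] c := Filter.eventually_of_mem (isOpen_Ioo.mem_nhds hmem) he₁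
    rw [he₁ hmem]
    exact (hc ξ hmem).congr_of_eventuallyEq hev
  · have hmem : ξ ∈ Ioo a b' := ⟨hab.trans_le h, hξ.2⟩
    have hev : c'' =ᶠ[𝓝 ξ] c' := Filter.eventually_of_mem (isOpen_Ioo.mem_nhds hmem) he₂
    rw [he₂ hmem]
    exact (hc' ξ hmem).congr_of_eventuallyEq hev

/-- **Proposition 2.5, second part (abstract form), at `γ = 5/3`.** Let `1 < r < r*` and let `c₀`
solve (1.8) on `(a₀, T₀)` off the sonic lines, with `c₀(a) ∈ 𝒯^{(H)}` for some `a ∈ (a₀, T₀)`.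
Then `c₀` continues to a solution `c` on some `(a₀, b)`, `b ≥ T₀`, off the sonic lines, which on
`[a, b)` stays in `𝒯^{(H)} ∖ {D_Z = 0}` with `W` strictly decreasing, and `c(ξ) → P_s` as
`ξ → b⁻`. [cite: BuckmasterCaolaboraGomezserrano2025, Prop. 2.5, Remark 2.6] -/
theorem exists_continuation_tendsto_Ps (h1 : 1 < r) (hr : r < rstar) {H : ℝ}
    {c₀ : ℝ → ℝ × ℝ} {a₀ a T₀ : ℝ} (ha₀ : a₀ < a) (haT : a < T₀)
    (hc₀ : ∀ ξ ∈ Ioo a₀ T₀, HasDerivAt c₀ (field r (c₀ ξ)) ξ)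
    (hU₀ : ∀ ξ ∈ Ioo a₀ T₀, c₀ ξ ∈ offSonic) (hin : c₀ a ∈ tri r H) :
    ∃ b : ℝ, T₀ ≤ b ∧ ∃ c : ℝ → ℝ × ℝ, EqOn c c₀ (Ioo a₀ T₀) ∧
      (∀ ξ ∈ Ioo a₀ b, HasDerivAt c (field r (c ξ)) ξ) ∧ (∀ ξ ∈ Ioo a₀ b, c ξ ∈ offSonic) ∧
      (∀ ξ ∈ Ico a b, c ξ ∈ tri r H ∧ DZ (c ξ).1 (c ξ).2 < 0) ∧
      StrictAntiOn (fun ξ => (c ξ).1) (Ico a b) ∧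
      Tendsto c (𝓝[<] b) (𝓝 (W0 r, Z0 r)) := by
  have hF : ∀ p ∈ offSonic, ContDiffAt ℝ 1 (field r) p := fun p hp => contDiffAt_field_of_mem hp
  rcases exists_maximal hF (ha₀.trans haT) hc₀ hU₀ with ⟨c, hce, hcd, hcU⟩ | ⟨b, hT₀b, c, hce, hcd, hcU, hmax⟩
  · -- a complete trajectory is impossible
    exfalso
    have hca : c a = c₀ a := hce ⟨ha₀, haT⟩
    refine not_forall_hasDerivAt_of_tri h1 hr H (c := c) (a := a)
      (fun ξ hξ => hcd ξ (ha₀.trans_le hξ)) (fun ξ hξ => (hcU ξ (ha₀.trans_le hξ)).2) ?_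
    rw [hca]; exact hin
  · have hab : a < b := haT.trans_le hT₀b
    have hca : c a = c₀ a := hce ⟨ha₀, haT⟩
    have hc' : ∀ ξ ∈ Ico a b, HasDerivAt c (field r (c ξ)) ξ := fun ξ hξ => hcd ξ ⟨ha₀.trans_le hξ.1, hξ.2⟩
    have hDZ' : ∀ ξ ∈ Ico a b, DZ (c ξ).1 (c ξ).2 ≠ 0 := fun ξ hξ => (hcU ξ ⟨ha₀.trans_le hξ.1, hξ.2⟩).2
    have h0 : c a ∈ tri r H := by rw [hca]; exact hin
    have hin' := triangle_invariant h1 hr H hc' hDZ' h0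
    have hanti := (triangle_W_strictAnti h1 hr H hc' hDZ' h0).2
    -- maximality in the form required by `tendsto_Ps_of_maximal`
    have hmax' : ∀ (c' : ℝ → ℝ × ℝ) (b' : ℝ), b < b' → EqOn c' c (Ioo a b) →
        (∀ ξ ∈ Ioo a b', HasDerivAt c' (field r (c' ξ)) ξ) → ¬ ∀ ξ ∈ Ioo a b', c' ξ ∈ offSonic := by
      intro c' b' hbb' heq hd' hU'
      obtain ⟨c'', he₁, he₂, hd''⟩ := hasDerivAt_splice hab hcd hd' heq
      refine hmax c'' b' hbb' he₁ hd'' fun ξ hξ => ?_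
      rcases lt_or_ge ξ b with h | h
      · rw [he₁ ⟨hξ.1, h⟩]; exact hcU ξ ⟨hξ.1, h⟩
      · rw [he₂ ⟨hab.trans_le h, hξ.2⟩]; exact hU' ξ ⟨hab.trans_le h, hξ.2⟩
    refine ⟨b, hT₀b, c, hce, hcd, hcU, fun ξ hξ => ⟨⟨(hin' ξ hξ).1, (hin' ξ hξ).2.1,
      (hin' ξ hξ).2.2.le⟩, (hin' ξ hξ).2.2⟩, hanti, ?_⟩
    exact tendsto_Ps_of_maximal h1 hr H hab hc' hDZ' h0 hmax'


/-- **Proposition 2.5 (second part) at `γ = 5/3`: the smooth solution issued from `P₀` reaches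
`P_s`.** [cite: BuckmasterCaolaboraGomezserrano2025, Prop. 2.5, Remark 2.6] -/
theorem exists_trajectory_of_profile (h1 : 1 < r) (hr : r < rstar) {𝒲 : ℝ → ℝ} {ρ : ℝ}
    (hρ : 0 < ρ) (h0 : 0 < 𝒲 0) (hd0 : HasDerivAt 𝒲 (1 - r) 0)
    (hdiff : ∀ ζ : ℝ, |ζ| < ρ → DifferentiableAt ℝ 𝒲 ζ)
    (hode : ∀ ζ : ℝ, ζ ≠ 0 → |ζ| < ρ →
      (r - 1) * 𝒲 ζ + (ζ + 1 / 2 * (𝒲 ζ - 𝒲 (-ζ) + 1 / 3 * (𝒲 ζ + 𝒲 (-ζ)))) * deriv 𝒲 ζ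
        + 1 / 3 / (2 * ζ) * (𝒲 ζ ^ 2 - 𝒲 (-ζ) ^ 2) = 0) :
    ∃ ξ₁ b : ℝ, ∃ c : ℝ → ℝ × ℝ, ξ₁ < b ∧
      (∀ ξ : ℝ, ξ ≤ ξ₁ → c ξ = (WofProfile 𝒲 ξ, ZofProfile 𝒲 ξ)) ∧
      (∀ ξ ∈ Iio b, HasDerivAt c (field r (c ξ)) ξ) ∧
      (∀ ξ ∈ Iio b, 0 < DW (c ξ).1 (c ξ).2 ∧ DZ (c ξ).1 (c ξ).2 < 0 ∧ (c ξ).2 < (c ξ).1) ∧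
      StrictAntiOn (fun ξ => (c ξ).1) (Ico ξ₁ b) ∧
      Tendsto c (𝓝[<] b) (𝓝 (W0 r, Z0 r)) := by
  have hr2 : r < 2 := by linarith [rstar_lt]
  -- Step 1: a time `ξ₂` before which everything is explicit
  have hent := eventually_entry h1 hr hd0 h0
  have hsmall : ∀ᶠ ξ : ℝ in atBot, Real.exp ξ < ρ :=
    (Real.tendsto_exp_atBot.eventually (gt_mem_nhds hρ))
  obtain ⟨ξ₂, hξ₂⟩ := (hent.and hsmall).exists_forall_of_atBot
  set c₀ : ℝ → ℝ × ℝ := fun ξ => (WofProfile 𝒲 ξ, ZofProfile 𝒲 ξ) with hc₀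
  have hsol₀ : ∀ ξ, ξ ≤ ξ₂ → HasDerivAt c₀ (field r (c₀ ξ)) ξ := by
    intro ξ hξ
    obtain ⟨⟨kDW, kDZ, _, _⟩, kρ⟩ := hξ₂ ξ hξ
    have hpos : 0 < Real.exp ξ := Real.exp_pos ξ
    have habs : |Real.exp ξ| < ρ := by rwa [abs_of_pos hpos]
    have habs' : |(-Real.exp ξ)| < ρ := by rwa [abs_neg, abs_of_pos hpos]
    have e2 := hode (-Real.exp ξ) (neg_ne_zero.mpr hpos.ne') habs'
    simp only [neg_neg] at e2
    exact hasDerivAt_WZofProfile (hdiff _ habs) (hdiff _ habs') (hode _ hpos.ne' habs) e2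
      kDW.ne' kDZ.ne
  have hU₀ : ∀ ξ, ξ ≤ ξ₂ → c₀ ξ ∈ offSonic := fun ξ hξ =>
    ⟨(hξ₂ ξ hξ).1.1.ne', (hξ₂ ξ hξ).1.2.1.ne⟩
  -- Step 2: continuation to `P_s` from the entry time `a = ξ₂ - 1`
  set a : ℝ := ξ₂ - 1 with ha
  set H : ℝ := (c₀ a).1 - W0 r with hH
  have hin : c₀ a ∈ tri r H := by
    obtain ⟨⟨_, kDZ, kW, kuv⟩, _⟩ := hξ₂ a (by simp only [ha]; linarith)
    exact ⟨by simp only [hH]; linarith, kuv, kDZ.le⟩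
  obtain ⟨b, hξ₂b, c, hce, hcd, hcU, htri, hanti, htend⟩ :=
    exists_continuation_tendsto_Ps h1 hr (H := H) (c₀ := c₀) (a₀ := ξ₂ - 2) (a := a) (T₀ := ξ₂)
      (by simp only [ha]; linarith) (by simp only [ha]; linarith)
      (fun ξ hξ => hsol₀ ξ hξ.2.le) (fun ξ hξ => hU₀ ξ hξ.2.le) hin
  have hab : a < b := by simp only [ha]; linarith
  -- Step 3: splice `c₀` (before `a`) with `c`
  set g : ℝ → ℝ × ℝ := fun ξ => if ξ < a then c₀ ξ else c ξ with hg
  have hgc : EqOn g c (Ioo (ξ₂ - 2) b) := fun ξ hξ => by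
    by_cases h : ξ < a
    · simp only [hg, if_pos h]; exact (hce ⟨hξ.1, by simp only [ha] at h; linarith⟩).symm
    · simp only [hg, if_neg h]
  have hgc₀ : ∀ ξ, ξ < ξ₂ → g ξ = c₀ ξ := fun ξ hξ => by
    by_cases h : ξ < a
    · simp only [hg, if_pos h]
    · simp only [hg, if_neg h]
      exact hce ⟨by simp only [ha] at h; linarith, hξ⟩
  refine ⟨a, b, g, hab, fun ξ hξ => hgc₀ ξ (by simp only [ha] at hξ; linarith), ?_, ?_, ?_, ?_⟩
  · -- solution on `(-∞, b)`
    intro ξ hξ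
    rcases lt_or_ge ξ ξ₂ with h | h
    · have hev : g =ᶠ[𝓝 ξ] c₀ := Filter.eventually_of_mem (Iio_mem_nhds h) fun s hs => hgc₀ s hs
      rw [hgc₀ ξ h]
      exact (hsol₀ ξ h.le).congr_of_eventuallyEq hev
    · have hmem : ξ ∈ Ioo (ξ₂ - 2) b := ⟨by linarith, hξ⟩
      have hev : g =ᶠ[𝓝 ξ] c := Filter.eventually_of_mem (isOpen_Ioo.mem_nhds hmem) hgc
      rw [hgc hmem]
      exact (hcd ξ hmem).congr_of_eventuallyEq hev
  · -- off the sonic lines, `Z < W`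
    intro ξ hξ
    rcases lt_or_ge ξ ξ₂ with h | h
    · rw [hgc₀ ξ h]
      obtain ⟨⟨kDW, kDZ, _, _⟩, _⟩ := hξ₂ ξ h.le
      refine ⟨kDW, kDZ, ?_⟩
      have e : DW (c₀ ξ).1 (c₀ ξ).2 - DZ (c₀ ξ).1 (c₀ ξ).2 = ((c₀ ξ).1 - (c₀ ξ).2) / 3 := by
        unfold DW DZ; ring
      nlinarith
    · have hmem : ξ ∈ Ioo (ξ₂ - 2) b := ⟨by linarith, hξ⟩
      have hIco : ξ ∈ Ico a b := ⟨by simp only [ha]; linarith, hξ⟩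
      rw [hgc hmem]
      obtain ⟨ht, hDZ⟩ := htri ξ hIco
      exact ⟨DW_pos_of_triangle hr2 ht.2.1 ht.2.2, hDZ, W_gt_Z_of_triangle hr2 ht.2.1 ht.2.2⟩
  · -- `W` strictly decreasing on `[a, b)`
    intro ξ hξ ξ' hξ' hlt
    have e1 : g ξ = c ξ := hgc ⟨by simp only [ha] at hξ; linarith [hξ.1], hξ.2⟩
    have e2 : g ξ' = c ξ' := hgc ⟨by simp only [ha] at hξ'; linarith [hξ'.1], hξ'.2⟩
    simp only [e1, e2]
    exact hanti hξ hξ' hlt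
  · -- the limit
    have hev : g =ᶠ[𝓝[<] b] c :=
      Filter.eventually_of_mem (Ioo_mem_nhdsLT hab) fun ξ hξ =>
        hgc ⟨by simp only [ha] at hξ; linarith [hξ.1], hξ.2⟩
    exact htend.congr' (hev.mono fun ξ hξ => hξ.symm)


/-- **Proposition 2.5 of Buckmaster–Cao-Labora–Gómez-Serrano at `γ = 5/3`.**
[cite: BuckmasterCaolaboraGomezserrano2025, Prop. 2.5, Remark 2.6] -/
theorem exists_P0_trajectory {r : ℝ} (h1 : 1 < r) (hr : r < rstar) {A : ℝ} (hA : 0 < A) :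
    ∃ ξ₁ b : ℝ, ∃ c : ℝ → ℝ × ℝ, ξ₁ < b ∧
      (∀ ξ : ℝ, ξ ≤ ξ₁ → c ξ = (WofProfile (OriginSeries.profile r A) ξ,
        ZofProfile (OriginSeries.profile r A) ξ)) ∧
      (∀ ξ ∈ Iio b, HasDerivAt c (field r (c ξ)) ξ) ∧
      (∀ ξ ∈ Iio b, 0 < DW (c ξ).1 (c ξ).2 ∧ DZ (c ξ).1 (c ξ).2 < 0 ∧ (c ξ).2 < (c ξ).1) ∧
      StrictAntiOn (fun ξ => (c ξ).1) (Ico ξ₁ b) ∧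
      Tendsto c (𝓝[<] b) (𝓝 (W0 r, Z0 r)) := by
  obtain ⟨hρ, h0, hd0, hdiff, hode⟩ := OriginSeries.originSeries_input (r := r) hA
  exact exists_trajectory_of_profile h1 hr hρ h0 hd0 hdiff hode

/-- The origin profile is analytic at `0` with value `A` — the remaining inputs of
`thm11_monatomic_of_meeting`. [cite: BuckmasterCaolaboraGomezserrano2025, Prop. 2.5] -/
theorem originProfile_analytic {r A : ℝ} (hA : 0 < A) :
    AnalyticAt ℝ (OriginSeries.profile r A) 0 ∧ OriginSeries.profile r A 0 = A :=
  ⟨OriginSeries.analyticAt_profile hA.ne' (by rw [abs_zero]; exact OriginSeries.rad_pos),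
    OriginSeries.profile_zero⟩

end Monatomic

end BuckmasterCaolaboraGomezserrano2025

end Literature.Analysis.FluidPDE
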